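import Literature.MeasureTheory.Group.LatticeCovolumeProd
import Literature.NumberTheory.Automorphic.UnitaryGroupCovolWeightStable
import HarnessLib

/-!
# The covolume weight of an adelic centraliser of `U(H)` SPLITS as a product of unitary covolumes along any product model
(Rogawski, *Automorphic Representations of Unitary Groups in Three Variables* (1990), §3.8 Prop. 3.8.1 (a) p. 27: `G_γ ≅ U(H_a) × U(H_b)` at a
singular semisimple `γ`; §14.5 Lemma 14.5.2 (b) p. 238: the covolumes `m(Z_{γ}(F) \ Z_γ(𝔸))` of the stabilised elliptic term; Gelbart (1975)
Remark 9.23: covolumes are transport-invariant; Folland (1995) (2.52): product quotient measures)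

Topic `NumberTheory/Automorphic`; namespace `Literature.NumberTheory.Automorphic.UnitaryGroup`.  THEOREMS ONLY (no definition, no instance, no
named fact, no `sorry`).  Cell `pub/hodgecm-mathlib`, crux H413 = stmt-HodgeConjecture-24833, road D-T clause (K7-s) of ★ S1′
`Rogawski1990.TamagawaSingularMembersExist` :240–:254 («(K7-s)-SPLIT»; censuses `CENSUS-DT-K7s.F0P3p03g8.md`, `CENSUS-K7s-inner-LetterConstant.F0P3p03g8.md`).

★ `Literature.MeasureTheory.Group.covolume_count_eq_mul_of_mulEquiv_prod` («(K7-s)-FACTOR») is GENERIC and carries twenty lattice-side instance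
binders.  This file is its junction IN THE LETTERS OF THE (K7-s) CLAUSE: the ambient groups are the adelic points `(cmDatum L N H).Adelic`,
`(cmDatum L Na Ha).Adelic`, `(cmDatum L Nb Hb).Adelic` of unitary groups over a CM field, the lattices are the rational points `quotientSubgroup`
(discrete, countable, closed: ★ `discreteTopology_∕countable_∕isClosed_cmDatum_quotientSubgroup`) and `U(H)(L⁺) ∩ Z(γ)` inside the adelic centraliser
`Z(γ)` (★ `UnitaryGroupCovolWeightStable` §0), and EVERY instance binder of the generic brick is discharged here, so that a consumer holding

* a product model `e : U(H_a)(𝔸) × U(H_b)(𝔸) ≃ₜ* Z(γ)` with the LATTICE CLAUSE `e u ∈ U(H)(L⁺) ∩ Z(γ) ↔ u ∈ U(H_a)(L⁺) × U(H_b)(L⁺)`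
  («(K7-s)-DOCK», `UnitaryGroupSingularCentralizerDock`: Rogawski's frame `γP = P(a·1₂ ⊕ᶠ b·1₁)`), and
* Haar data matched along it, `e_* (t_a ⊗ t_b) = νZ`,

gets, BY NAME and with no instance bookkeeping,

* **`covol_centralizer_eq_mul_of_continuousMulEquiv_prod`**:
  `quotientMeasure ((quotientSubgroup ⊓ Z(γ)).subgroupOf Z(γ)) count _ νZ univ = quotientMeasure quotientSubgroup count _ t_a univ * quotientMeasure quotientSubgroup count _ t_b univ`
  — the left side is the (K7-s) covolume currency VERBATIM (closedness proofs are the caller's, matched by proof irrelevance).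

Also recorded (§0): the lattice-side facts for the RATIONAL POINTS `quotientSubgroup ≤ (cmDatum L N H).Adelic` themselves (`count` is a Haar measure) and
for products of two such lattices (discrete, countable, `count` Haar) — the discharges used in §1.

## References
* J. D. Rogawski, *Automorphic Representations of Unitary Groups in Three Variables*, Ann. of Math. Stud. 123 (1990), §3.8 Prop. 3.8.1 (a) p. 27;
  §14.5 Lemma 14.5.2 (b) p. 238 [Rogawski1990].
* S. Gelbart, *Automorphic forms on adele groups*, Ann. of Math. Stud. 83 (1975), Remark 9.23 p. 155 [Gelbart1975].
* G. B. Folland, *A Course in Abstract Harmonic Analysis* (1995), §2.6 Thm. 2.49, (2.52) [Folland1995].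
-/

set_option autoImplicit false

noncomputable section

open MeasureTheory MeasureTheory.Measure Topology Set NumberField
open Literature.MeasureTheory.Group

namespace Literature.NumberTheory.Automorphic

namespace UnitaryGroup

variable (L : Type) [Field L] [NumberField L] [IsCMField L]

/-! ## §0 Lattice-side facts for the rational points and for products of two rational lattices -/

section Lattice

variable (N : ℕ) (H : Matrix (Fin N) (Fin N) L)

/-- **`count` on the rational points `U(H)(L⁺) ≤ U(H)(𝔸_{L⁺})` is a Haar measure** (discrete countable subgroup: ★
`discreteTopology_cmDatum_quotientSubgroup`, ★ `countable_cmDatum_quotientSubgroup`, ★ `isHaarMeasure_count_of_discrete`).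
[cite: Rogawski1990, §14.5 p. 238] [cite: Gelbart1975, Remark 9.23] -/
theorem isHaarMeasure_count_quotientSubgroup [MeasurableSpace (cmDatum L N H).Adelic] [BorelSpace (cmDatum L N H).Adelic] :
    (count : Measure ↥(cmDatum L N H).quotientSubgroup).IsHaarMeasure := by
  haveI := discreteTopology_cmDatum_quotientSubgroup L N H
  haveI := countable_cmDatum_quotientSubgroup L N H
  haveI : MeasurableSingletonClass (cmDatum L N H).Adelic := inferInstance
  exact isHaarMeasure_count_of_discrete

variable (Na Nb : ℕ) (Ha : Matrix (Fin Na) (Fin Na) L) (Hb : Matrix (Fin Nb) (Fin Nb) L)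

/-- The product `U(H_a)(L⁺) × U(H_b)(L⁺)` of two rational lattices, as a subgroup of `U(H_a)(𝔸) × U(H_b)(𝔸)`, is COUNTABLE. [cite: Rogawski1990, §14.5 p. 238] -/
theorem countable_quotientSubgroup_prod :
    Countable ↥(((cmDatum L Na Ha).quotientSubgroup).prod ((cmDatum L Nb Hb).quotientSubgroup)) := by
  haveI := countable_cmDatum_quotientSubgroup L Na Ha
  haveI := countable_cmDatum_quotientSubgroup L Nb Hb
  exact Countable.of_equiv _ (Subgroup.prodEquiv ((cmDatum L Na Ha).quotientSubgroup) ((cmDatum L Nb Hb).quotientSubgroup)).toEquiv.symm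

/-- … and DISCRETE (it injects continuously into the discrete `U(H_a)(L⁺) × U(H_b)(L⁺)`). [cite: Rogawski1990, §14.5 p. 238] -/
theorem discreteTopology_quotientSubgroup_prod :
    DiscreteTopology ↥(((cmDatum L Na Ha).quotientSubgroup).prod ((cmDatum L Nb Hb).quotientSubgroup)) := by
  haveI := discreteTopology_cmDatum_quotientSubgroup L Na Ha
  haveI := discreteTopology_cmDatum_quotientSubgroup L Nb Hb
  refine DiscreteTopology.of_continuous_injective
    (f := fun x : ↥(((cmDatum L Na Ha).quotientSubgroup).prod ((cmDatum L Nb Hb).quotientSubgroup)) =>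
      ((⟨(x : (cmDatum L Na Ha).Adelic × (cmDatum L Nb Hb).Adelic).1, (Subgroup.mem_prod.1 x.2).1⟩ : ↥(cmDatum L Na Ha).quotientSubgroup),
       (⟨(x : (cmDatum L Na Ha).Adelic × (cmDatum L Nb Hb).Adelic).2, (Subgroup.mem_prod.1 x.2).2⟩ : ↥(cmDatum L Nb Hb).quotientSubgroup))) ?_ ?_
  · exact ((continuous_fst.comp continuous_subtype_val).subtype_mk _).prodMk ((continuous_snd.comp continuous_subtype_val).subtype_mk _)
  · intro x y hxy
    apply Subtype.ext
    have h1 := congrArg (fun p => ((p.1 : ↥(cmDatum L Na Ha).quotientSubgroup) : (cmDatum L Na Ha).Adelic)) hxy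
    have h2 := congrArg (fun p => ((p.2 : ↥(cmDatum L Nb Hb).quotientSubgroup) : (cmDatum L Nb Hb).Adelic)) hxy
    exact Prod.ext h1 h2

/-- **`count` on the product lattice `U(H_a)(L⁺) × U(H_b)(L⁺)` is a Haar measure.** [cite: Rogawski1990, §14.5 p. 238] [cite: Gelbart1975, Remark 9.23] -/
theorem isHaarMeasure_count_quotientSubgroup_prod
    [MeasurableSpace (cmDatum L Na Ha).Adelic] [BorelSpace (cmDatum L Na Ha).Adelic]
    [MeasurableSpace (cmDatum L Nb Hb).Adelic] [BorelSpace (cmDatum L Nb Hb).Adelic] :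
    (count : Measure ↥(((cmDatum L Na Ha).quotientSubgroup).prod ((cmDatum L Nb Hb).quotientSubgroup))).IsHaarMeasure := by
  haveI := discreteTopology_quotientSubgroup_prod L Na Nb Ha Hb
  haveI := countable_quotientSubgroup_prod L Na Nb Ha Hb
  haveI : MeasurableSingletonClass (cmDatum L Na Ha).Adelic := inferInstance
  haveI : MeasurableSingletonClass (cmDatum L Nb Hb).Adelic := inferInstance
  exact isHaarMeasure_count_of_discrete

end Lattice

/-! ## §1 The (K7-s) covolume currency splits along a product model -/

section Split

variable {N Na Nb : ℕ} (H : Matrix (Fin N) (Fin N) L) (Ha : Matrix (Fin Na) (Fin Na) L) (Hb : Matrix (Fin Nb) (Fin Nb) L)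
  [MeasurableSpace (cmDatum L N H).Adelic] [BorelSpace (cmDatum L N H).Adelic]
  [MeasurableSpace (cmDatum L Na Ha).Adelic] [BorelSpace (cmDatum L Na Ha).Adelic]
  [MeasurableSpace (cmDatum L Nb Hb).Adelic] [BorelSpace (cmDatum L Nb Hb).Adelic]
  (γ : (cmDatum L N H).Adelic)
  [MeasurableSpace ((cmDatum L Na Ha).Adelic ⧸ (cmDatum L Na Ha).quotientSubgroup)]
  [BorelSpace ((cmDatum L Na Ha).Adelic ⧸ (cmDatum L Na Ha).quotientSubgroup)]
  [MeasurableSpace ((cmDatum L Nb Hb).Adelic ⧸ (cmDatum L Nb Hb).quotientSubgroup)]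
  [BorelSpace ((cmDatum L Nb Hb).Adelic ⧸ (cmDatum L Nb Hb).quotientSubgroup)]
  [MeasurableSpace (↥(Subgroup.centralizer ({γ} : Set (cmDatum L N H).Adelic)) ⧸
    ((cmDatum L N H).quotientSubgroup ⊓ Subgroup.centralizer ({γ} : Set (cmDatum L N H).Adelic)).subgroupOf
      (Subgroup.centralizer ({γ} : Set (cmDatum L N H).Adelic)))]
  [BorelSpace (↥(Subgroup.centralizer ({γ} : Set (cmDatum L N H).Adelic)) ⧸
    ((cmDatum L N H).quotientSubgroup ⊓ Subgroup.centralizer ({γ} : Set (cmDatum L N H).Adelic)).subgroupOf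
      (Subgroup.centralizer ({γ} : Set (cmDatum L N H).Adelic)))]
  -- the standing families of the (K7-s) frame (★ S1′ :80–:86): `Z(γ)` closed, `count` on the lattices a Haar measure (all three DISCHARGEABLE: ★
  -- `isClosed_centralizer_cmDatum`, ★ `isHaarMeasure_count_quotientSubgroup_inf_centralizer_subgroupOf`, §0 `isHaarMeasure_count_quotientSubgroup`)
  [hZ : IsClosed ((Subgroup.centralizer ({γ} : Set (cmDatum L N H).Adelic) : Subgroup (cmDatum L N H).Adelic) : Set (cmDatum L N H).Adelic)]
  [(count : Measure ↥(((cmDatum L N H).quotientSubgroup ⊓ Subgroup.centralizer ({γ} : Set (cmDatum L N H).Adelic)).subgroupOf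
      (Subgroup.centralizer ({γ} : Set (cmDatum L N H).Adelic)))).IsHaarMeasure]
  [(count : Measure ↥(cmDatum L Na Ha).quotientSubgroup).IsHaarMeasure] [(count : Measure ↥(cmDatum L Nb Hb).quotientSubgroup).IsHaarMeasure]

/-- **(K7-s)-SPLIT.**  Let `γ ∈ U(H)(𝔸_{L⁺})`, `Z(γ)` its adelic centraliser, and let `e : U(H_a)(𝔸) × U(H_b)(𝔸) ≃ₜ* Z(γ)` be an isomorphism of
topological groups carrying the product of the rational lattices onto `U(H)(L⁺) ∩ Z(γ)` (`hΛe`) and the product Haar measure `t_a ⊗ t_b` to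
`νZ` (`hν`).  Then the covolume weight of the (K7-s) clause splits:
`vol(U(H)(L⁺) ∩ Z(γ) \ Z(γ); νZ) = vol(U(H_a)(L⁺) \ U(H_a)(𝔸); t_a) · vol(U(H_b)(L⁺) \ U(H_b)(𝔸); t_b)` (counting measures on the lattices).
★ `covolume_count_eq_mul_of_mulEquiv_prod` with its remaining lattice-side instances discharged (§0 for the product lattice, ★ `UnitaryGroupCovolWeightStable` §0,
Mathlib's `count.IsInvInvariant` ∕ σ-finiteness of `count` on countable types); the product quotient carries its Borel σ-algebra; the three standing
instance binders (`Z(γ)` closed, `count` Haar on the two kinds of lattice) are those of the (K7-s) frame and are themselves ★∕§0-dischargeable.  At Rogawski's frame of a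
singular semisimple rational `γ` this is «`m(I_γ(F) \ I_γ(𝔸)) = m(U(H_a)(F) \ U(H_a)(𝔸)) · m(U(H_b)(F) \ U(H_b)(𝔸))`».
[cite: Rogawski1990, §3.8 Prop. 3.8.1 (a) p. 27; §14.5 Lemma 14.5.2 (b) p. 238] [cite: Gelbart1975, Remark 9.23] [cite: Folland1995, §2.6 (2.52)] -/
theorem covol_centralizer_eq_mul_of_continuousMulEquiv_prod
    (hΛ : IsClosed ((((cmDatum L N H).quotientSubgroup ⊓ Subgroup.centralizer ({γ} : Set (cmDatum L N H).Adelic)).subgroupOf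
      (Subgroup.centralizer ({γ} : Set (cmDatum L N H).Adelic)) :
        Subgroup ↥(Subgroup.centralizer ({γ} : Set (cmDatum L N H).Adelic))) : Set ↥(Subgroup.centralizer ({γ} : Set (cmDatum L N H).Adelic))))
    (hqa : IsClosed (((cmDatum L Na Ha).quotientSubgroup : Subgroup (cmDatum L Na Ha).Adelic) : Set (cmDatum L Na Ha).Adelic))
    (hqb : IsClosed (((cmDatum L Nb Hb).quotientSubgroup : Subgroup (cmDatum L Nb Hb).Adelic) : Set (cmDatum L Nb Hb).Adelic))
    (e : ((cmDatum L Na Ha).Adelic × (cmDatum L Nb Hb).Adelic) ≃ₜ* ↥(Subgroup.centralizer ({γ} : Set (cmDatum L N H).Adelic)))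
    (hΛe : ∀ u, e u ∈ ((cmDatum L N H).quotientSubgroup ⊓ Subgroup.centralizer ({γ} : Set (cmDatum L N H).Adelic)).subgroupOf
        (Subgroup.centralizer ({γ} : Set (cmDatum L N H).Adelic)) ↔
      u ∈ ((cmDatum L Na Ha).quotientSubgroup).prod ((cmDatum L Nb Hb).quotientSubgroup))
    (ta : Measure (cmDatum L Na Ha).Adelic) [IsHaarMeasure ta] [ta.IsMulRightInvariant]
    (tb : Measure (cmDatum L Nb Hb).Adelic) [IsHaarMeasure tb] [tb.IsMulRightInvariant]
    (νZ : Measure ↥(Subgroup.centralizer ({γ} : Set (cmDatum L N H).Adelic))) [IsHaarMeasure νZ] [νZ.IsMulRightInvariant]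
    (hν : Measure.map e (ta.prod tb) = νZ) :
    quotientMeasure (((cmDatum L N H).quotientSubgroup ⊓ Subgroup.centralizer ({γ} : Set (cmDatum L N H).Adelic)).subgroupOf
        (Subgroup.centralizer ({γ} : Set (cmDatum L N H).Adelic))) count hΛ νZ Set.univ =
      quotientMeasure (cmDatum L Na Ha).quotientSubgroup count hqa ta Set.univ *
        quotientMeasure (cmDatum L Nb Hb).quotientSubgroup count hqb tb Set.univ := by
  -- (`Z(γ)` is locally compact by ★ `locallyCompactSpace_coe_of_isClosed` from `hZ`; second countable, T₂ as a subgroup type)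
  -- singletons are measurable everywhere (Borel, T₂)
  haveI : MeasurableSingletonClass (cmDatum L N H).Adelic := inferInstance
  haveI : MeasurableSingletonClass (cmDatum L Na Ha).Adelic := inferInstance
  haveI : MeasurableSingletonClass (cmDatum L Nb Hb).Adelic := inferInstance
  -- the three lattices are countable and carry Haar counting measures
  haveI := countable_cmDatum_quotientSubgroup L Na Ha
  haveI := countable_cmDatum_quotientSubgroup L Nb Hb
  haveI := countable_quotientSubgroup_prod L Na Nb Ha Hb
  haveI := countable_quotientSubgroup_inf_centralizer_subgroupOf L N H γ
  haveI := isHaarMeasure_count_quotientSubgroup_prod L Na Nb Ha Hb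
  -- the product quotient carries its Borel σ-algebra (it does not appear in the statement)
  letI : MeasurableSpace (((cmDatum L Na Ha).Adelic × (cmDatum L Nb Hb).Adelic) ⧸
      ((cmDatum L Na Ha).quotientSubgroup).prod ((cmDatum L Nb Hb).quotientSubgroup)) := borel _
  haveI : BorelSpace (((cmDatum L Na Ha).Adelic × (cmDatum L Nb Hb).Adelic) ⧸
      ((cmDatum L Na Ha).quotientSubgroup).prod ((cmDatum L Nb Hb).quotientSubgroup)) := ⟨rfl⟩
  haveI : IsClosed (((cmDatum L Na Ha).quotientSubgroup : Subgroup (cmDatum L Na Ha).Adelic) : Set (cmDatum L Na Ha).Adelic) := hqa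
  haveI : IsClosed (((cmDatum L Nb Hb).quotientSubgroup : Subgroup (cmDatum L Nb Hb).Adelic) : Set (cmDatum L Nb Hb).Adelic) := hqb
  haveI : IsClosed ((((cmDatum L N H).quotientSubgroup ⊓ Subgroup.centralizer ({γ} : Set (cmDatum L N H).Adelic)).subgroupOf
      (Subgroup.centralizer ({γ} : Set (cmDatum L N H).Adelic)) :
        Subgroup ↥(Subgroup.centralizer ({γ} : Set (cmDatum L N H).Adelic))) : Set ↥(Subgroup.centralizer ({γ} : Set (cmDatum L N H).Adelic))) := hΛ
  exact covolume_count_eq_mul_of_mulEquiv_prod ((cmDatum L Na Ha).quotientSubgroup) ((cmDatum L Nb Hb).quotientSubgroup) ta tb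
    e.toMulEquiv e.continuous e.symm.continuous _ hΛe νZ hν

end Split

end UnitaryGroup

end Literature.NumberTheory.Automorphic
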